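import Literature.AlgebraicGeometry.Motives.ProjectiveSpaceComplexPointsOrientation
import Literature.AlgebraicGeometry.Motives.HypersurfaceFieldPoints
import Literature.AlgebraicGeometry.Motives.Sweep1
import Literature.FieldTheory.QuasiAlgClosed.Basic
import Literature.AlgebraicTopology.SingularHomology.TripleSequence
import HarnessLib

/-!
# The complex points of `ℙᴺ_ℂ ∖ V₊(F)` are the open set `{[z] | F(z) ≠ 0}` of the manifold `ℂℙᴺ`

Family `hodge`, layer `Literature/AlgebraicGeometry/HodgeTheory`.  A brick (the topological
identification) of the Andreotti–Frankel input still missing for the named fact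
`Voisin2003_smoothHypersurface_algebraicClasses_eq_top` (C. Voisin, *Hodge Theory and Complex
Algebraic Geometry II* (2003), §1.2.2–1.2.3): `HypersurfaceLefschetzFromVanishing.lean` reduces that
fact to hard Lefschetz and to the vanishing `H_j((ℙ^{m+1} ∖ Y)(ℂ); ℂ) = 0`, `j ≥ m + 2`, for the
complement of the hypersurface `Y = V₊(F)`, phrased on the complex points
`↥(range Y(ℂ) → ℙ^{m+1}(ℂ))ᶜ` with their analytic topology.  Morse theory (the tree's
`Literature/Topology/FourManifolds`, e.g. `MorseHomologyVanishing.lean`) lives on the smooth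
manifold `ComplexProjectiveSpace N = ℙ(ℂ^{N+1})` (`FourManifolds/ComplexProjectiveSpace.lean`).  This
file identifies the two sides:

* `ComplexProjectiveSpace.hypersurfaceComplement F hF` — the open subset `U_F = {[z] | F(z) ≠ 0}` of
  `ℂℙᴺ` for a homogeneous form `F` (well defined: `F(t z) = tᵈ F(z)`), with
  `mk_mem_hypersurfaceComplement_iff`;
* `AlgPoints.mem_range_map_iff_pt_mem` — for a closed `k`-immersion `ι : Z → X`, an `L`-point `P` of
  `X` comes from `Z(L)` iff its underlying point lies on `ι(Z)` (Hartshorne II Ex. 2.7, 3.11(d); the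
  tree's `AlgPoints.liftClosed`);
* `complRangeHomeomorph` — for `ι : Y → ℙᴺ_ℂ` a closed immersion onto `V₊(F)` (`deg F ≥ 1`), the
  homeomorphism `↥(range Y(ℂ) → ℙᴺ(ℂ))ᶜ ≃ₜ U_F` induced by Serre's comparison
  `ℙᴺ_ℂ(ℂ) ≃ₜ ℂℙᴺ` (GAGA §2 n°5; the tree's `complexPointsProjectiveSpaceHomeomorph`, with
  `[z] ∈ D₊(F) ⟺ F(z) ≠ 0`, `pt_projPoint_mk_mem_basicOpen_iff`);
* `isZero_singularHomology_compl_range_of` — hence `H_j(U_F; M) = 0 ⟹ H_j(↥(range Y(ℂ))ᶜ; M) = 0`.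

## References

* [SerreGAGA1956] J.-P. Serre, GAGA, Ann. Inst. Fourier 6 (1956), §2 n°5 Prop. 2.
* [Hartshorne1977] R. Hartshorne, Algebraic Geometry (1977), II Prop. 2.5, II Ex. 2.7, 2.14, 3.11(d).
* [VoisinHodgeII2003] C. Voisin, Hodge Theory and Complex Algebraic Geometry II (CUP 2003), §1.2.2
  Thm. 1.22–1.23.
-/

noncomputable section

open scoped LinearAlgebra.Projectivization
open CategoryTheory AlgebraicGeometry Topology CategoryTheory.Limits
open Literature.AlgebraicTopology.SingularHomology

/-! ### The open set `{[z] | F(z) ≠ 0}` of `ℂℙᴺ` -/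

namespace Literature.Topology.FourManifolds.ComplexProjectiveSpace

variable {N : ℕ}

/-- The predicate `F(z) ≠ 0` on `ℂℙᴺ`, for a homogeneous form `F` of degree `d`: well defined on
homogeneous coordinates since `F(t z) = tᵈ F(z)` (Hartshorne I §2, p. 9). [folklore] -/
def FormNeZero (F : MvPolynomial (Fin (N + 1)) ℂ) {d : ℕ} (hF : F.IsHomogeneous d) :
    ComplexProjectiveSpace N → Prop :=
  Projectivization.lift (fun v ↦ MvPolynomial.eval (v : Fin (N + 1) → ℂ) F ≠ 0) (by
    rintro a b t h
    have ht : t ≠ 0 := by rintro rfl; exact a.2 (by simpa using h)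
    have hab : MvPolynomial.eval (a : Fin (N + 1) → ℂ) F =
        t ^ d * MvPolynomial.eval (b : Fin (N + 1) → ℂ) F := by
      rw [h, hF.eval_smul_eq]
    simp only [hab, ne_eq, mul_eq_zero, pow_eq_zero_iff', ht, false_and, false_or])

/-- `FormNeZero F [v]` unfolds to `F(v) ≠ 0`. [folklore] -/
@[simp] theorem formNeZero_mk (F : MvPolynomial (Fin (N + 1)) ℂ) {d : ℕ} (hF : F.IsHomogeneous d)
    (v : {v : Fin (N + 1) → ℂ // v ≠ 0}) :
    FormNeZero F hF (mk v) ↔ MvPolynomial.eval (v : Fin (N + 1) → ℂ) F ≠ 0 :=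
  Iff.rfl

/-- **The complement `U_F = {[z] | F(z) ≠ 0}` of the hypersurface `F = 0` in `ℂℙᴺ`**, an open
subset (the preimage of the open set `{F ≠ 0} ⊆ ℂ^{N+1} ∖ {0}` under the quotient map), as an open
submanifold of the tree's `ComplexProjectiveSpace N`. [folklore] -/
def hypersurfaceComplement (F : MvPolynomial (Fin (N + 1)) ℂ) {d : ℕ} (hF : F.IsHomogeneous d) :
    TopologicalSpace.Opens (ComplexProjectiveSpace N) :=
  ⟨{x | FormNeZero F hF x}, by
    rw [← isQuotientMap_mk.isOpen_preimage]
    exact isOpen_ne_fun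
      (f := fun v : {v : Fin (N + 1) → ℂ // v ≠ 0} ↦ MvPolynomial.eval (v : Fin (N + 1) → ℂ) F)
      (g := fun _ ↦ 0) ((MvPolynomial.continuous_eval F).comp continuous_subtype_val)
      continuous_const⟩

/-- `[v] ∈ U_F ⟺ F(v) ≠ 0`. [folklore] -/
@[simp] theorem mk_mem_hypersurfaceComplement_iff (F : MvPolynomial (Fin (N + 1)) ℂ) {d : ℕ}
    (hF : F.IsHomogeneous d) (v : {v : Fin (N + 1) → ℂ // v ≠ 0}) :
    mk v ∈ hypersurfaceComplement F hF ↔ MvPolynomial.eval (v : Fin (N + 1) → ℂ) F ≠ 0 :=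
  Iff.rfl

/-- Membership in `U_F` is the predicate `FormNeZero`. [folklore] -/
theorem mem_hypersurfaceComplement_iff (F : MvPolynomial (Fin (N + 1)) ℂ) {d : ℕ}
    (hF : F.IsHomogeneous d) (x : ComplexProjectiveSpace N) :
    x ∈ hypersurfaceComplement F hF ↔ FormNeZero F hF x :=
  Iff.rfl

end Literature.Topology.FourManifolds.ComplexProjectiveSpace

/-! ### Points of a closed subscheme, and the complex points off `V₊(F)` -/

namespace Literature.AlgebraicGeometry.Motives.AlgPoints

universe u

variable {k : Type u} [Field k] {X Z : SchemeOver k} (ι : Z ⟶ X) {L : Type u} [Field L] [Algebra k L]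

/-- **An `L`-point of `X` comes from the closed subscheme `Z` iff its underlying point lies on
`ι(Z)`** (`Spec L` is reduced, so it lifts along the closed immersion; Hartshorne II Ex. 2.7 with
Ex. 3.11(d); the tree's `AlgPoints.liftClosed`). [cite: Hartshorne1977, II Ex. 2.7 and Ex. 3.11(d)] -/
theorem mem_range_map_iff_pt_mem [IsClosedImmersion ι.left] (P : AlgPoints X L) :
    P ∈ Set.range (map (L := L) ι) ↔ P.pt ∈ Set.range ι.left := by
  constructor
  · rintro ⟨Q, rfl⟩
    exact pt_map_mem_range ι Q
  · intro h
    exact ⟨P.liftClosed ι h, map_liftClosed ι P h⟩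

end Literature.AlgebraicGeometry.Motives.AlgPoints

namespace Literature.AlgebraicGeometry.HodgeTheory

open Literature.Topology.FourManifolds Literature.AlgebraicGeometry.Motives
open Literature.NumberTheory.Transcendental (projPoint isHomeomorph_projPoint
  pt_projPoint_mk_mem_basicOpen_iff)

attribute [local instance] MvPolynomial.gradedAlgebra

variable {N : ℕ}

/-- The grading of `ℂ[x₀, …, x_N]` by degree (`ℙᴺ_ℂ = Proj 𝓐`). -/
local notation "𝓐" => MvPolynomial.homogeneousSubmodule (Fin (N + 1)) ℂ

/-- The comparison `ℙᴺ_ℂ(ℂ) ≃ₜ ℂℙᴺ` sends back `[v] ∈ ℂℙᴺ` to Serre's `projPoint [v]`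
(definitional). [cite: SerreGAGA1956, §2 n°5 Prop. 2] -/
theorem complexPointsProjectiveSpaceHomeomorph_symm_mk (v : {v : Fin (N + 1) → ℂ // v ≠ 0}) :
    (complexPointsProjectiveSpaceHomeomorph N).symm (ComplexProjectiveSpace.mk v) =
      projPoint N (Projectivization.mk ℂ (v : Fin (N + 1) → ℂ) v.2) :=
  rfl

/-- **Complex points off `V₊(F)`**: for a closed immersion `ι : Y → ℙᴺ_ℂ` with image `V₊(F)`,
`F` homogeneous of degree `d ≥ 1`, a complex point of `ℙᴺ_ℂ` is NOT in the image of `Y(ℂ)` iff,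
read in `ℂℙᴺ` through `ℙᴺ_ℂ(ℂ) ≃ₜ ℂℙᴺ`, it lies in `U_F = {[z] | F(z) ≠ 0}`
(`[z] ∈ D₊(F) ⟺ F(z) ≠ 0`, Hartshorne II Prop. 2.5; Ex. 2.14). [cite: Hartshorne1977, II Prop. 2.5 and Ex. 2.14] -/
theorem notMem_range_map_iff {Y : SchemeOver ℂ} (ι : Y ⟶ projectiveSpace N ℂ)
    [IsClosedImmersion ι.left] {F : MvPolynomial (Fin (N + 1)) ℂ} {d : ℕ} (hF : F.IsHomogeneous d)
    (hd : 0 < d) (hι : Set.range ι.left.base = ProjectiveSpectrum.zeroLocus 𝓐 {F})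
    (P : ComplexPoints (projectiveSpace N ℂ)) :
    P ∉ Set.range (AlgPoints.map (L := ℂ) ι) ↔
      complexPointsProjectiveSpaceHomeomorph N P ∈
        ComplexProjectiveSpace.hypersurfaceComplement F hF := by
  -- write `P = e⁻¹ x`, `x = [v]`
  obtain ⟨x, rfl⟩ := (complexPointsProjectiveSpaceHomeomorph N).symm.surjective P
  rw [Homeomorph.apply_symm_apply]
  induction x using ComplexProjectiveSpace.ind with
  | h v =>
    rw [complexPointsProjectiveSpaceHomeomorph_symm_mk,
      ComplexProjectiveSpace.mk_mem_hypersurfaceComplement_iff,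
      AlgPoints.mem_range_map_iff_pt_mem,
      ← pt_projPoint_mk_mem_basicOpen_iff N (v : Fin (N + 1) → ℂ) v.2 hd
        ((MvPolynomial.mem_homogeneousSubmodule d F).2 hF)]
    refine Iff.trans ?_ (Proj.mem_basicOpen 𝓐 F _).symm
    rw [hι]
    exact not_congr ((ProjectiveSpectrum.mem_zeroLocus _ _ _).trans Set.singleton_subset_iff)

/-- **`(ℙᴺ ∖ V₊(F))(ℂ) ≃ₜ U_F`**: the complex points of `ℙᴺ_ℂ` off the image of a closed immersion
`ι : Y → ℙᴺ_ℂ` onto `V₊(F)` (`deg F ≥ 1`), with their analytic topology, are homeomorphic to the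
open subset `{[z] | F(z) ≠ 0}` of the manifold `ℂℙᴺ` (Serre's comparison, GAGA §2 n°5; the tree's
`complexPointsProjectiveSpaceHomeomorph`). [cite: SerreGAGA1956, §2 n°5 Prop. 2] -/
def complRangeHomeomorph {Y : SchemeOver ℂ} (ι : Y ⟶ projectiveSpace N ℂ) [IsClosedImmersion ι.left]
    {F : MvPolynomial (Fin (N + 1)) ℂ} {d : ℕ} (hF : F.IsHomogeneous d) (hd : 0 < d)
    (hι : Set.range ι.left.base = ProjectiveSpectrum.zeroLocus 𝓐 {F}) :
    ↥(Set.range (AlgPoints.map (L := ℂ) ι))ᶜ ≃ₜ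
      ↥(ComplexProjectiveSpace.hypersurfaceComplement F hF) :=
  (complexPointsProjectiveSpaceHomeomorph N).subtype fun P ↦ notMem_range_map_iff ι hF hd hι P

/-- **`H_j(U_F; M) = 0 ⟹ H_j((ℙᴺ ∖ V₊(F))(ℂ); M) = 0`** (homeomorphic spaces,
`complRangeHomeomorph`). [cite: SerreGAGA1956, §2 n°5 Prop. 2] -/
theorem isZero_singularHomology_compl_range_of {R M : Type} [CommRing R] [AddCommGroup M]
    [Module R M] {Y : SchemeOver ℂ} (ι : Y ⟶ projectiveSpace N ℂ) [IsClosedImmersion ι.left]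
    {F : MvPolynomial (Fin (N + 1)) ℂ} {d : ℕ} (hF : F.IsHomogeneous d) (hd : 0 < d)
    (hι : Set.range ι.left.base = ProjectiveSpectrum.zeroLocus 𝓐 {F}) {j : ℕ}
    (h : IsZero (singularHomology R M ↥(ComplexProjectiveSpace.hypersurfaceComplement F hF) j)) :
    IsZero (singularHomology R M (↥(Set.range (AlgPoints.map (L := ℂ) ι))ᶜ) j) :=
  h.of_iso ((HomologicalComplex.homologyFunctor _ _ j).mapIso
    (singularChainComplex.mapHomeomorph R M (complRangeHomeomorph ι hF hd hι)))

end Literature.AlgebraicGeometry.HodgeTheory
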